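import Summits.ABC.ABC.Theses.IsogenyGlueCongruence
import Summits.ABC.ABC.Theorems.IsogenyGlueCongruencePolyDegreeOfBoundedPrimesManinBoundOfFacts

/-!
# `SemistableManinBound` (stmt-ABC-16013) closed modulo its printed inputs, and with
# Edixhoven's Prop. 2 removed from the list

Route `IsogenyGlueCongruence`, support item `SemistableManinBound` (rank 9, known in print, formal
debt): there is an absolute `M₀` such that every globally minimal elliptic `W/ℚ` carrying a modular
parametrisation datum `D` at a square-free level `N` carries a datum `D'` with the same newform and
`|c_{D'}| ≤ M₀`.

* `semistableManinBound_of_facts` — the item with `M₀ = 163` from the FOUR named inputs of the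
  planner's certificate (`maninBound_of_facts`, p114821): Edixhoven 1991 Prop. 2 in lattice form
  (the route item `EdixhovenIntegrality`, verbatim the named fact
  `edixhoven_int_of_neronLattice_eq_smul_periodLattice`), Česnavičius 2018 Thm. 1.2 in datum form
  (the closure of `ModularParametrizationData.abs_maninConstant_eq_one_of_isSemistable`), the route
  item `MazurKenkuBound` (verbatim `PastenShimura2024_minimalDegree_le_163_mul`) and the Néron
  scaling integrality `integral_neronScaling_of_isGloballyMinimal`.
* `maninBound_of_cesnaviciusLattice`, `semistableManinBound_of_cesnaviciusLattice` — the same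
  conclusion from THREE inputs, WITHOUT Edixhoven's Prop. 2: at a square-free level Česnavičius's
  theorem in lattice form ("a globally minimal elliptic `W'/ℚ` with newform `f ∈ S₂(Γ₀(N))`, `N`
  squarefree, whose Néron-type lattice is exactly `q Λ_f` with `q ∈ ℚ`, has `q = ±1`"; Česnavičius
  2018, Thm. 1.2 with Agashe–Ribet–Stein 2006 §5: `c Λ_f = Λ_{E}`) already delivers the optimal
  datum on a globally minimal model together with `|c₀| = 1` (tree theorem
  `ModularParametrizationData.exists_optimalDatum_abs_maninConstant_eq_one`), so the integrality of
  the optimal Manin constant is not a separate input. The rest is the argument of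
  `maninBound_of_facts`: Mazur–Kenku in lattice form gives `k ≠ 0` with `k Λ_f ⊆ Λ_W` and
  `m = [Λ_W : k Λ_f] ≤ 163`; `m` kills `Λ_W / kΛ_f`, so `(m c₀ / k) Λ_W ⊆ c₀ Λ_f = Λ_{W₀}`, and the
  Néron scaling between the globally minimal `W`, `W₀` makes `m c₀ / k` a nonzero integer, whence
  `|k| ≤ m ≤ 163`; finally `D` may be given the Manin constant `k` (`exists_datum_c_eq`).

References: K. Česnavičius, *The Manin constant in the semistable case*, Compositio Math. 154
(2018), Thm. 1.2; A. Agashe, K. Ribet, W. A. Stein, *The Manin constant*, Pure Appl. Math. Q. 2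
(2006), Thm. 2.2 and §5; B. Edixhoven, *On the Manin constants of modular elliptic curves* (1991),
Prop. 2; H. Pasten, *Shimura curves and the abc conjecture*, J. Number Theory 254 (2024), §3 p. 13;
J. H. Silverman, *Advanced Topics in the Arithmetic of Elliptic Curves*, GTM 151 (1994), IV.5.1.
-/

noncomputable section

-- single-conjunct summit ABC: the duplicate ABC.ABC is mandated (CONVENTIONS §2)
set_option linter.dupNamespace false

namespace Summit.ABC.ABC.Theorems

open Literature.NumberTheory.EllipticCurves Literature.NumberTheory.EllipticCurves.ModularForms
  CongruenceSubgroup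
open Summit.ABC.ABC.Theses.IsogenyGlueCongruence

/-- **`SemistableManinBound` from the four printed inputs** (`M₀ = 163`): the route item
`EdixhovenIntegrality` (`hEd`, verbatim the named fact
`edixhoven_int_of_neronLattice_eq_smul_periodLattice`: Edixhoven 1991 Prop. 2 in lattice form),
Česnavičius 2018 Thm. 1.2 in datum form (`hCes`), the route item `MazurKenkuBound` (`hMK`, verbatim
`PastenShimura2024_minimalDegree_le_163_mul`: Mazur 1978 + Kenku 1982 as used by Pasten 2024 §3) and
the Néron scaling integrality (`hNS`, Silverman ATAEC IV.5.1); one line over `maninBound_of_facts`.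
[cite: EdixhovenManin1991, Prop. 2] [cite: Cesnavicius2018, Thm. 1.2]
[cite: PastenShimura2024, §3 p. 13] [cite: SilvermanATAEC1994, IV.5.1] -/
theorem semistableManinBound_of_facts (hEd : EdixhovenIntegrality)
    (hCes : ∀ {W' : WeierstrassCurve ℚ} {N' : ℕ} [NeZero N']
      (D' : ModularParametrizationData W' N'), D'.abs_maninConstant_eq_one_of_isSemistable)
    (hMK : MazurKenkuBound) (hNS : integral_neronScaling_of_isGloballyMinimal) :
    SemistableManinBound :=
  ⟨163, maninBound_of_facts hEd hCes hMK hNS⟩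

/-- **The bound `|c| ≤ 163` at square-free level WITHOUT Edixhoven's Prop. 2.** Inputs: (`hC`)
Česnavičius's theorem in lattice form at square-free levels — for `N` squarefree, a globally
minimal elliptic `W'/ℚ` with newform `f ∈ S₂(Γ₀(N))` whose Néron-type period pair spans exactly
`q Λ_f`, `q ∈ ℚ`, has `q = ±1` (Česnavičius 2018, Thm. 1.2: the Manin constant of the `X₀(N)`-optimal
curve of a square-free conductor `N` is `±1`; lattice form `c Λ_f = Λ_E`, Agashe–Ribet–Stein 2006
§5 p. 632); (`h163`) Mazur–Kenku as `PastenShimura2024_minimalDegree_le_163_mul`; (`hNS`) the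
integrality of the Néron scaling between globally minimal models. Then every globally minimal
elliptic `W/ℚ` with a datum `D` at a square-free level `N` has a datum `D'` with `D'.f = D.f` and
`|c_{D'}| ≤ 163`. Proof: `hC` gives a globally minimal `W₀` with a lattice-optimal datum `D₀`,
`D₀.f = D.f`, `|c₀| = 1` (`exists_optimalDatum_abs_maninConstant_eq_one`); Mazur–Kenku in lattice
form (`PastenShimura2024_minimalDegree_le_163_mul_iff`) gives `k ≠ 0`, `k Λ_f ⊆ Λ_W`,
`m = #ker(z ↦ kz : ℂ/Λ_f → ℂ/Λ_W) ≤ 163`; `m` kills the kernel, so `(m c₀ / k) Λ_W ⊆ c₀ Λ_f ⊆ Λ_{W₀}`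
and `hNS` makes `m c₀ / k = j ∈ ℤ ∖ {0}`, i.e. `|k| ≤ |j| |k| = m ≤ 163`; and `D` may be given the
Manin constant `k` (`exists_datum_c_eq`). [cite: Cesnavicius2018, Thm. 1.2]
[cite: AgasheRibetStein2006, §5 (p. 632)] [cite: PastenShimura2024, §3 p. 13]
[cite: SilvermanATAEC1994, IV.5.1] -/
theorem maninBound_of_cesnaviciusLattice
    (hC : ∀ {N : ℕ} [NeZero N] {W' : WeierstrassCurve ℚ} [W'.IsElliptic] [W'.IsGloballyMinimal]
      {f : CuspForm (Gamma0 N) 2} {L' : PeriodPair}, Squarefree N → IsNewformOf W' f →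
      IsNeronLatticeOf (W'.baseChange ℂ) L' → ∀ q : ℚ,
      (∀ z ∈ periodLattice f, (q : ℂ) * z ∈ L'.lattice) →
      (∀ z ∈ L'.lattice, ∃ w ∈ periodLattice f, z = q * w) → q = 1 ∨ q = -1)
    (h163 : PastenShimura2024_minimalDegree_le_163_mul)
    (hNS : integral_neronScaling_of_isGloballyMinimal)
    (N : ℕ) [NeZero N] (W : WeierstrassCurve ℚ) [W.IsElliptic] [W.IsGloballyMinimal]
    (D : ModularParametrizationData W N) (hsq : Squarefree N) :
    ∃ D' : ModularParametrizationData W N, D'.f = D.f ∧ |D'.maninConstant| ≤ 163 := by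
  -- (1) Mazur–Kenku in lattice form: `k ∈ ℤ`, `k ≠ 0`, `k Λ_f ⊆ Λ_W`, `#ker(z ↦ kz) ≤ 163`
  obtain ⟨k, hk, hk0, hcard⟩ := PastenShimura2024_minimalDegree_le_163_mul_iff.mp h163 D
  have hkC : (k : ℂ) ≠ 0 := Int.cast_ne_zero.mpr hk0
  -- the kernel is finite, of order `m ≥ 1`
  haveI := discreteTopology_periodLattice_of_mul_mem D.f hkC hk
  obtain ⟨b, hb⟩ := exists_basis_span_eq_periodLattice D.f D.isNewformOf.1.ne_zero
  haveI hfin : Finite (mulQuotientMap (periodLattice D.f) D.L.lattice.toAddSubgroup (k : ℂ) hk).ker :=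
    finite_ker_mulQuotientMap b hb D.L hk hkC
  set m : ℕ := Nat.card (mulQuotientMap (periodLattice D.f) D.L.lattice.toAddSubgroup (k : ℂ) hk).ker
    with hm
  have hmpos : 0 < m := Nat.card_pos
  -- (2) Česnavičius in lattice form: the optimal datum on a globally minimal model, `|c₀| = 1`
  obtain ⟨W₀, hW₀, hW₀', D₀, hf₀, -, hc₀, -, -⟩ :=
    D.exists_optimalDatum_abs_maninConstant_eq_one (fun hf' hL' q hq hq' ↦ hC hsq hf' hL' q hq hq')
  haveI := hW₀
  haveI := hW₀'
  -- (3) `(m c₀ / k) Λ_W ⊆ Λ_{W₀}`: `m` kills the kernel, so `m k⁻¹ Λ_W ⊆ Λ_f`, and `c₀ Λ_f ⊆ Λ_{W₀}`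
  set q : ℚ := (m : ℚ) * D₀.c / k with hq_def
  have hq : ∀ w ∈ D.L.lattice, ((q : ℚ) : ℂ) * w ∈ D₀.L.lattice := by
    intro w hw
    set z : ℂ := (k : ℂ)⁻¹ * w with hz_def
    have hkz : (k : ℂ) * z = w := mul_inv_cancel_left₀ hkC w
    -- the class of `z` lies in the kernel
    have hzker : (z : ℂ ⧸ periodLattice D.f) ∈
        (mulQuotientMap (periodLattice D.f) D.L.lattice.toAddSubgroup (k : ℂ) hk).ker := by
      rw [AddMonoidHom.mem_ker, mulQuotientMap_mk, QuotientAddGroup.eq_zero_iff, hkz]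
      exact hw
    -- a finite group is killed by its order
    have hmz0 : m • (z : ℂ ⧸ periodLattice D.f) = 0 := by
      have h := congrArg Subtype.val (card_nsmul_eq_zero' (x := (⟨_, hzker⟩ :
        (mulQuotientMap (periodLattice D.f) D.L.lattice.toAddSubgroup (k : ℂ) hk).ker)))
      rw [AddSubgroupClass.coe_nsmul, ZeroMemClass.coe_zero, ← hm] at h
      exact h
    have hmz : (m : ℂ) * z ∈ periodLattice D₀.f := by
      rw [hf₀, ← QuotientAddGroup.eq_zero_iff, ← nsmul_eq_mul, QuotientAddGroup.mk_nsmul]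
      exact hmz0
    have key := D₀.smul_periodLattice_le _ hmz
    have hqw : ((q : ℚ) : ℂ) * w = (D₀.c : ℂ) * ((m : ℂ) * z) := by
      rw [hq_def, ← hkz]
      push_cast
      field_simp
    rw [hqw]
    exact key
  -- (4) Néron scaling between the globally minimal models `W`, `W₀`: `m c₀ / k = j ∈ ℤ`, so `|k| ≤ m`
  obtain ⟨j, hj⟩ := hNS W W₀ D.L D₀.L D.isNeronLattice D₀.isNeronLattice q hq
  have hjk : j * k = (m : ℤ) * D₀.c := by
    have hkQ : (k : ℚ) ≠ 0 := Int.cast_ne_zero.mpr hk0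
    have h : (j : ℚ) * k = (m : ℚ) * D₀.c := by
      rw [hj, hq_def]
      field_simp
    exact_mod_cast h
  have habs : |j| * |k| = (m : ℤ) := by
    rw [← abs_mul, hjk, abs_mul, Nat.abs_cast, show |D₀.c| = 1 from hc₀, mul_one]
  have hj0 : j ≠ 0 := by
    rintro rfl
    rw [abs_zero, zero_mul] at habs
    omega
  have hkm : |k| ≤ (m : ℤ) :=
    calc |k| = 1 * |k| := (one_mul _).symm
      _ ≤ |j| * |k| := mul_le_mul_of_nonneg_right (Int.one_le_abs hj0) (abs_nonneg k)
      _ = m := habs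
  -- (5) the datum with Manin constant `k`
  obtain ⟨Dk, hfk, -, -, hck⟩ := D.exists_datum_c_eq hk0 hk
  refine ⟨Dk, hfk, ?_⟩
  show |Dk.c| ≤ 163
  rw [hck]
  calc |k| ≤ (m : ℤ) := hkm
    _ ≤ 163 := by exact_mod_cast hcard

/-- **`SemistableManinBound` without Edixhoven's Prop. 2** (`M₀ = 163`): from Česnavičius 2018
Thm. 1.2 in lattice form at square-free levels (`hC`), the route item `MazurKenkuBound` (`hMK`,
verbatim `PastenShimura2024_minimalDegree_le_163_mul`) and the Néron scaling integrality (`hNS`),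
by `maninBound_of_cesnaviciusLattice`. [cite: Cesnavicius2018, Thm. 1.2]
[cite: PastenShimura2024, §3 p. 13] [cite: SilvermanATAEC1994, IV.5.1] -/
theorem semistableManinBound_of_cesnaviciusLattice
    (hC : ∀ {N : ℕ} [NeZero N] {W' : WeierstrassCurve ℚ} [W'.IsElliptic] [W'.IsGloballyMinimal]
      {f : CuspForm (Gamma0 N) 2} {L' : PeriodPair}, Squarefree N → IsNewformOf W' f →
      IsNeronLatticeOf (W'.baseChange ℂ) L' → ∀ q : ℚ,
      (∀ z ∈ periodLattice f, (q : ℂ) * z ∈ L'.lattice) →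
      (∀ z ∈ L'.lattice, ∃ w ∈ periodLattice f, z = q * w) → q = 1 ∨ q = -1)
    (hMK : MazurKenkuBound) (hNS : integral_neronScaling_of_isGloballyMinimal) :
    SemistableManinBound :=
  ⟨163, maninBound_of_cesnaviciusLattice hC hMK hNS⟩

end Summit.ABC.ABC.Theorems

end
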